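import Mathlib
import Summits.NavierStokesRegularity.NavierStokesRegularity.Theorems.WakeRatchetTailRatchetScalarFrontPositiveWake
import HarnessLib

/-!
# Scalar dyadic fronts (construction `DyadicScalarFronts`, stmt-NavierStokesRegularity-21808):
# every non-trivial admissible front is STRICTLY POSITIVE on its whole life, and quasi-monotone

Support file for the crux `WakeRatchet.TailRatchet` (stmt-21808; refuted BY NAME modulo the construction
`WakeRatchetDyadicFront.DyadicScalarFronts`, p589335).  The construction asks for a profile `a` on `t < 0` of
the scalar front equation of the inviscid dyadic chain at base `Λ = bigLam ε₀`,
  `a'(t) = (Λ/s²)·a(t/s)² − (s/Λ)·a(t)·a(st)`   (`t < 0`, `s > 1`),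
integrable on `(−∞,0)`, bounded near `0⁻`, non-trivial.  The tree's a-priori package
(`…ScalarFrontAdmissible`, `…ScalarFrontLimit`, `…ScalarFrontWake`, `…ScalarFrontPositiveWake`) gives entry from
rest, the wake limit `a(0⁻) = L`, the wake–throughput identity and `L > 0` «whatever the sign pattern of the
profile».  This file settles the sign pattern:

* `lower_gronwall` — the SIGNED lower Gronwall bound from the leading edge: since the feed `(Λ/s²)a(t/s)²` is
  non-negative, `E(t) = −a(t)·exp((s/Λ)∫_{t₀}^{t} a(su)du)` is non-increasing on `t < 0`, i.e.
  `a(t) ≥ a(t₀)·exp(−(s/Λ)∫_{t₀}^{t} a(su)du)` for `t₀ ≤ t < 0` (no sign hypothesis on `a`);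
* `nonneg` — a profile entering from rest (`a → 0` at `−∞`) and integrable on `(−∞,0)` is `≥ 0` on `t < 0`
  (let `t₀ → −∞`: the exponent stays bounded by `‖a(s·)‖_{L¹}`, the prefactor tends to `0`);
* `eq_zero_of_zero` — a zero of a non-negative profile propagates: backwards along the Gronwall bound and
  towards `0⁻` through the feed term (`a(t₁) = 0` is a minimum, so `a'(t₁) = 0 = (Λ/s²)a(t₁/s)²`), hence
  `a ≡ 0` on `(−∞,0)`;
* `pos_of_front` — consequently EVERY NON-TRIVIAL PROFILE WITH THE CLAUSES OF `DyadicScalarFronts` IS STRICTLY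
  POSITIVE on `(−∞,0)` (`nonneg_of_front` for the non-strict form);
* `quasi_monotone` / `wake_ge` — for a non-negative profile the drain exponent is at most `A/Λ`,
  `A = ∫_{t<0} a`, so `a(t) ≥ e^{−A/Λ}·a(t₀)` for all `t₀ ≤ t < 0` and the wake retains a fixed fraction of
  every earlier value, `a(0⁻) ≥ e^{−A/Λ}·a(t₀)` — the profile can dip (the inner front overshoots, item evidence
  `SPEC-21808-leafhand4-g0.md`) but never below `e^{−A/Λ}` times its running maximum;
* `flux_integral_pos_of_front` — the throughput `∫_{t<0} a(t)²a(st) dt` of a non-trivial admissible front is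
  positive (the hypothesis `hQ` of `WakeRatchetScalarFrontAdmissible.lt_bigLam_of_front` is automatic).

USE (census of stmt-21808, programme R-glob): compactness / non-collapse / continuation arguments for the branch of
fronts may be run inside the open positive cone; the leading-edge comparison `0 ≤ a' ≤ (Λ/s²)a(·/s)²`
(`deriv_le_feed`) is available along every admissible front.

HONEST FRAMING: elementary real analysis about a MODEL lattice ODE (Tao 2016 §1.2, §4); the existence of such
fronts is NOT proved; nothing here concerns the Navier–Stokes equations; no item is closed.
-/

noncomputable section

set_option linter.dupNamespace false

namespace Summit.NavierStokesRegularity.NavierStokesRegularity.Theorems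

namespace WakeRatchetScalarFrontPositive

open Filter Topology Set MeasureTheory intervalIntegral
open Literature.Analysis.FluidPDE Literature.Analysis.FluidPDE.TaoCascade
open WakeRatchetScalarFrontWake WakeRatchetScalarFrontPositiveWake WakeRatchetScalarFrontAdmissible

variable {ε₀ s : ℝ} {a : ℝ → ℝ}

/-! ## The drain primitive and the signed lower Gronwall bound -/

/-- The dilated profile `t ↦ a(st)` is continuous on `t < 0` (`s > 0`). [elementary] -/
theorem continuousOn_comp_mul (hs : 0 < s) (hcont : ContinuousOn a (Iio 0)) :
    ContinuousOn (fun t => a (s * t)) (Iio 0) :=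
  hcont.comp (continuous_const.mul continuous_id).continuousOn (fun _ ht => mul_neg_of_pos_of_neg hs ht)

/-- The drain primitive `t ↦ c·∫_{t₀}^{t} a(sv) dv` has derivative `c·a(st)` at every `t < 0` (`t₀ < 0`).
[elementary] -/
theorem hasDerivAt_drainPrim (hs : 0 < s) (hcont : ContinuousOn a (Iio 0)) {t₀ t : ℝ} (ht₀ : t₀ < 0)
    (ht : t < 0) (c : ℝ) :
    HasDerivAt (fun u => c * ∫ v in t₀..u, a (s * v)) (c * a (s * t)) t := by
  have hc2 := continuousOn_comp_mul hs hcont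
  have hsub : uIcc t₀ t ⊆ Iio 0 := by
    intro v hv
    rcases le_total t₀ t with h | h
    · rw [uIcc_of_le h] at hv; exact lt_of_le_of_lt hv.2 ht
    · rw [uIcc_of_ge h] at hv; exact lt_of_le_of_lt hv.2 ht₀
  have hii : IntervalIntegrable (fun v => a (s * v)) volume t₀ t := (hc2.mono hsub).intervalIntegrable
  have hmeas : StronglyMeasurableAtFilter (fun v => a (s * v)) (𝓝 t) :=
    hc2.stronglyMeasurableAtFilter isOpen_Iio t ht
  have hca : ContinuousAt (fun v => a (s * v)) t := hc2.continuousAt (Iio_mem_nhds ht)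
  exact (intervalIntegral.integral_hasDerivAt_right hii hmeas hca).const_mul c

/-- **Signed lower Gronwall bound from the leading edge.**  For every profile of the scalar front equation on
`t < 0` (no sign, integrability or boundedness hypothesis) and all `t₀ ≤ t < 0`:
`a(t) ≥ a(t₀) · exp(−(s/Λ) ∫_{t₀}^{t} a(sv) dv)` — the feed is non-negative, so
`−a(t)·exp((s/Λ)∫_{t₀}^{t} a(s·))` is non-increasing.
[cite: Tao2016AveragedNS, §1.2 (dyadic model); elementary] -/
theorem lower_gronwall (hε : 0 < ε₀) (hs : 1 < s)
    (hode : ∀ t : ℝ, t < 0 → HasDerivAt a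
      (bigLam ε₀ / s ^ 2 * a (t / s) ^ 2 - s / bigLam ε₀ * a t * a (s * t)) t)
    {t₀ t : ℝ} (ht₀t : t₀ ≤ t) (ht : t < 0) :
    a t₀ * Real.exp (-(s / bigLam ε₀ * ∫ v in t₀..t, a (s * v))) ≤ a t := by
  have hs0 : 0 < s := by linarith
  have hΛ : 0 < bigLam ε₀ := bigLam_pos (by linarith)
  have ht₀ : t₀ < 0 := lt_of_le_of_lt ht₀t ht
  have hcont := continuousOn_of_ode hode
  set D : ℝ → ℝ := fun u => s / bigLam ε₀ * ∫ v in t₀..u, a (s * v) with hD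
  set E : ℝ → ℝ := fun u => -a u * Real.exp (D u) with hE
  have hD' : ∀ u, u < 0 → HasDerivAt D (s / bigLam ε₀ * a (s * u)) u := fun u hu =>
    hasDerivAt_drainPrim hs0 hcont ht₀ hu _
  have hE' : ∀ u, u < 0 → HasDerivAt E (-(bigLam ε₀ / s ^ 2 * a (u / s) ^ 2) * Real.exp (D u)) u := by
    intro u hu
    refine (((hode u hu).neg).mul (hD' u hu).exp).congr_deriv ?_
    simp only [Pi.neg_apply]
    ring
  have hanti : AntitoneOn E (Iio 0) := by
    refine antitoneOn_of_hasDerivWithinAt_nonpos (convex_Iio 0)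
      (f' := fun u => -(bigLam ε₀ / s ^ 2 * a (u / s) ^ 2) * Real.exp (D u))
      (fun u hu => (hE' u hu).continuousAt.continuousWithinAt) ?_ ?_
    · intro u hu
      rw [interior_Iio] at hu
      exact (hE' u hu).hasDerivWithinAt
    · intro u _
      have h0 : 0 ≤ bigLam ε₀ / s ^ 2 * a (u / s) ^ 2 * Real.exp (D u) := by positivity
      show -(bigLam ε₀ / s ^ 2 * a (u / s) ^ 2) * Real.exp (D u) ≤ 0
      linarith
  have hle := hanti (show t₀ ∈ Iio (0 : ℝ) from ht₀) (show t ∈ Iio (0 : ℝ) from ht) ht₀t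
  have hD0 : D t₀ = 0 := by simp [hD]
  have hle' : -a t * Real.exp (D t) ≤ -a t₀ := by
    have : E t ≤ E t₀ := hle
    simpa only [hE, hD0, Real.exp_zero, mul_one] using this
  have hpos : 0 < Real.exp (D t) := Real.exp_pos _
  have h1 : a t₀ ≤ a t * Real.exp (D t) := by linarith
  calc a t₀ * Real.exp (-(s / bigLam ε₀ * ∫ v in t₀..t, a (s * v)))
      = a t₀ * (Real.exp (D t))⁻¹ := by rw [Real.exp_neg]
    _ ≤ (a t * Real.exp (D t)) * (Real.exp (D t))⁻¹ :=
        mul_le_mul_of_nonneg_right h1 (inv_nonneg.2 hpos.le)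
    _ = a t := by field_simp

/-- The drain primitive is controlled by the `L¹` norm of the dilated profile:
`|∫_{t₀}^{t} a(sv) dv| ≤ ∫_{v<0} |a(sv)| dv` for `t₀ ≤ t < 0`. [elementary] -/
theorem drainPrim_abs_le (hs : 0 < s) (hint : IntegrableOn a (Iio 0))
    {t₀ t : ℝ} (ht₀t : t₀ ≤ t) (ht : t < 0) :
    |∫ v in t₀..t, a (s * v)| ≤ ∫ v in Iio 0, |a (s * v)| := by
  have habs : IntegrableOn (fun v => |a (s * v)|) (Iio 0) := (integrableOn_comp_mul hs hint).abs
  calc |∫ v in t₀..t, a (s * v)| ≤ ∫ v in t₀..t, |a (s * v)| :=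
        intervalIntegral.abs_integral_le_integral_abs ht₀t
    _ = ∫ v in Ioc t₀ t, |a (s * v)| := intervalIntegral.integral_of_le ht₀t
    _ ≤ ∫ v in Iio 0, |a (s * v)| := by
        have hsub : (Ioc t₀ t : Set ℝ) ≤ Iio 0 := fun v hv => lt_of_le_of_lt hv.2 ht
        exact setIntegral_mono_set habs (Eventually.of_forall fun v => abs_nonneg _) hsub.eventuallyLE

/-! ## Non-negativity from entry from rest -/

/-- **Non-negativity.**  A profile of the scalar front equation on `t < 0` which is integrable on `(−∞,0)` and
enters from rest (`a(t) → 0` as `t → −∞`) is non-negative on `t < 0`.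
[cite: Tao2016AveragedNS, §1.2 (dyadic model); elementary] -/
theorem nonneg (hε : 0 < ε₀) (hs : 1 < s)
    (hode : ∀ t : ℝ, t < 0 → HasDerivAt a
      (bigLam ε₀ / s ^ 2 * a (t / s) ^ 2 - s / bigLam ε₀ * a t * a (s * t)) t)
    (hint : IntegrableOn a (Iio 0)) (hbot : Tendsto a atBot (𝓝 0)) :
    ∀ t : ℝ, t < 0 → 0 ≤ a t := by
  intro t ht
  have hs0 : 0 < s := by linarith
  have hΛ : 0 < bigLam ε₀ := bigLam_pos (by linarith)
  set B : ℝ := s / bigLam ε₀ * ∫ v in Iio 0, |a (s * v)| with hB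
  have hcoef : 0 ≤ s / bigLam ε₀ := (div_pos hs0 hΛ).le
  -- for every `t₀ ≤ t`: `a t ≥ -|a t₀|·e^B`
  have key : ∀ t₀ : ℝ, t₀ ≤ t → -|a t₀| * Real.exp B ≤ a t := by
    intro t₀ ht₀t
    have hg := lower_gronwall hε hs hode ht₀t ht
    have hP := drainPrim_abs_le hs0 hint ht₀t ht
    have hexp : Real.exp (-(s / bigLam ε₀ * ∫ v in t₀..t, a (s * v))) ≤ Real.exp B := by
      apply Real.exp_le_exp.2
      have h1 : -(∫ v in t₀..t, a (s * v)) ≤ ∫ v in Iio 0, |a (s * v)| := by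
        have := neg_abs_le (∫ v in t₀..t, a (s * v)); linarith
      have h2 := mul_le_mul_of_nonneg_left h1 hcoef
      have h3 : -(s / bigLam ε₀ * ∫ v in t₀..t, a (s * v))
          = s / bigLam ε₀ * -(∫ v in t₀..t, a (s * v)) := by ring
      rw [h3]; exact h2
    rcases le_or_gt 0 (a t₀) with h0 | h0
    · have h1 : 0 ≤ a t₀ * Real.exp (-(s / bigLam ε₀ * ∫ v in t₀..t, a (s * v))) :=
        mul_nonneg h0 (Real.exp_pos _).le
      have h2 : -|a t₀| * Real.exp B ≤ 0 := by
        have := abs_nonneg (a t₀); have := Real.exp_pos B; nlinarith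
      linarith
    · rw [abs_of_neg h0, neg_neg]
      have h1 : a t₀ * Real.exp B ≤ a t₀ * Real.exp (-(s / bigLam ε₀ * ∫ v in t₀..t, a (s * v))) :=
        mul_le_mul_of_nonpos_left hexp h0.le
      linarith
  by_contra hneg
  have hneg : a t < 0 := lt_of_not_ge hneg
  have hEpos : 0 < Real.exp B := Real.exp_pos B
  have hev : ∀ᶠ t₀ in atBot, dist (a t₀) 0 < -a t / Real.exp B :=
    Metric.tendsto_nhds.1 hbot _ (div_pos (by linarith) hEpos)
  obtain ⟨t₀, h1, h2⟩ := (hev.and (eventually_le_atBot t)).exists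
  rw [Real.dist_eq, sub_zero, lt_div_iff₀ hEpos] at h1
  have h3 := key t₀ h2
  linarith

/-! ## Zeros propagate: a non-negative profile with one zero vanishes identically -/

/-- Backward propagation of a zero along the Gronwall bound: if `a ≥ 0` on `t < 0` and `a(t₁) = 0`, then
`a = 0` on `(−∞, t₁]`. [elementary] -/
theorem eq_zero_of_le (hε : 0 < ε₀) (hs : 1 < s)
    (hode : ∀ t : ℝ, t < 0 → HasDerivAt a
      (bigLam ε₀ / s ^ 2 * a (t / s) ^ 2 - s / bigLam ε₀ * a t * a (s * t)) t)
    (hnn : ∀ t : ℝ, t < 0 → 0 ≤ a t) {t₁ : ℝ} (ht₁ : t₁ < 0) (h0 : a t₁ = 0)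
    {t : ℝ} (htt : t ≤ t₁) : a t = 0 := by
  have hg := lower_gronwall hε hs hode htt ht₁
  rw [h0] at hg
  have hpos := Real.exp_pos (-(s / bigLam ε₀ * ∫ v in t..t₁, a (s * v)))
  have h1 : a t ≤ 0 := by
    by_contra h
    have h' : 0 < a t := lt_of_not_ge h
    have : 0 < a t * Real.exp (-(s / bigLam ε₀ * ∫ v in t..t₁, a (s * v))) := mul_pos h' hpos
    linarith
  exact le_antisymm h1 (hnn t (lt_of_le_of_lt htt ht₁))

/-- Forward propagation of a zero through the feed: if `a ≥ 0` on `t < 0` and `a(t₁) = 0` (`t₁ < 0`), then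
`t₁` is a minimum, so `a'(t₁) = 0 = (Λ/s²)·a(t₁/s)²`, i.e. `a(t₁/s) = 0`. [elementary] -/
theorem zero_div_of_zero (hε : 0 < ε₀) (hs : 1 < s)
    (hode : ∀ t : ℝ, t < 0 → HasDerivAt a
      (bigLam ε₀ / s ^ 2 * a (t / s) ^ 2 - s / bigLam ε₀ * a t * a (s * t)) t)
    (hnn : ∀ t : ℝ, t < 0 → 0 ≤ a t) {t₁ : ℝ} (ht₁ : t₁ < 0) (h0 : a t₁ = 0) : a (t₁ / s) = 0 := by
  have hs0 : 0 < s := by linarith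
  have hΛ : 0 < bigLam ε₀ := bigLam_pos (by linarith)
  have hmin : IsLocalMin a t₁ := by
    filter_upwards [Iio_mem_nhds ht₁] with u hu
    rw [h0]; exact hnn u hu
  have hder := hmin.hasDerivAt_eq_zero (hode t₁ ht₁)
  rw [h0, mul_zero, zero_mul, sub_zero] at hder
  have hc : bigLam ε₀ / s ^ 2 ≠ 0 := (div_pos hΛ (pow_pos hs0 2)).ne'
  exact pow_eq_zero_iff (n := 2) (by norm_num) |>.1 ((mul_eq_zero.1 hder).resolve_left hc)

/-- **A non-negative profile with one zero vanishes identically on `(−∞,0)`** (zeros march to `0⁻` along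
`t₁, t₁/s, t₁/s², …` and spread backwards from each of them). [elementary] -/
theorem eq_zero_of_zero (hε : 0 < ε₀) (hs : 1 < s)
    (hode : ∀ t : ℝ, t < 0 → HasDerivAt a
      (bigLam ε₀ / s ^ 2 * a (t / s) ^ 2 - s / bigLam ε₀ * a t * a (s * t)) t)
    (hnn : ∀ t : ℝ, t < 0 → 0 ≤ a t) {t₁ : ℝ} (ht₁ : t₁ < 0) (h0 : a t₁ = 0) :
    ∀ t : ℝ, t < 0 → a t = 0 := by
  have hs0 : 0 < s := by linarith
  have zeros : ∀ k : ℕ, a (t₁ / s ^ k) = 0 := by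
    intro k
    induction k with
    | zero => simpa using h0
    | succ k ih =>
      have e : t₁ / s ^ (k + 1) = (t₁ / s ^ k) / s := by rw [pow_succ, div_div]
      rw [e]
      exact zero_div_of_zero hε hs hode hnn (div_neg_of_neg_of_pos ht₁ (pow_pos hs0 k)) ih
  intro t ht
  obtain ⟨k, hk⟩ := pow_unbounded_of_one_lt (t₁ / t) hs
  have hsk : 0 < s ^ k := pow_pos hs0 k
  have hle : t ≤ t₁ / s ^ k := by
    rw [le_div_iff₀ hsk]
    have := (div_lt_iff_of_neg ht).1 hk
    linarith
  exact eq_zero_of_le hε hs hode hnn (div_neg_of_neg_of_pos ht₁ hsk) (zeros k) hle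

/-! ## Unconditional forms on the construction item's clauses -/

/-- **Every profile of `DyadicScalarFronts` is non-negative**: front equation on `t < 0`, integrable on
`(−∞,0)`, bounded near `0⁻` ⟹ `a ≥ 0` on `t < 0` (entry from rest is `…ScalarFrontAdmissible.tendsto_atBot`).
[cite: Tao2016AveragedNS, §1.2, §4; elementary] -/
theorem nonneg_of_front (hε : 0 < ε₀) (hs : 1 < s)
    (hode : ∀ t : ℝ, t < 0 → HasDerivAt a
      (bigLam ε₀ / s ^ 2 * a (t / s) ^ 2 - s / bigLam ε₀ * a t * a (s * t)) t)
    (hint : IntegrableOn a (Iio 0))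
    (hbdd : ∃ t₀ : ℝ, t₀ < 0 ∧ ∃ P : ℝ, ∀ t : ℝ, t₀ ≤ t → t < 0 → |a t| ≤ P) :
    ∀ t : ℝ, t < 0 → 0 ≤ a t :=
  nonneg hε hs hode hint (tendsto_atBot hε hs hode hint hbdd)

/-- **Every non-trivial profile of `DyadicScalarFronts` is STRICTLY POSITIVE on `(−∞,0)`.**
[cite: Tao2016AveragedNS, §1.2, §4; elementary] -/
theorem pos_of_front (hε : 0 < ε₀) (hs : 1 < s)
    (hode : ∀ t : ℝ, t < 0 → HasDerivAt a
      (bigLam ε₀ / s ^ 2 * a (t / s) ^ 2 - s / bigLam ε₀ * a t * a (s * t)) t)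
    (hint : IntegrableOn a (Iio 0))
    (hbdd : ∃ t₀ : ℝ, t₀ < 0 ∧ ∃ P : ℝ, ∀ t : ℝ, t₀ ≤ t → t < 0 → |a t| ≤ P)
    (hne : ∃ t : ℝ, t < 0 ∧ a t ≠ 0) :
    ∀ t : ℝ, t < 0 → 0 < a t := by
  have hnn := nonneg_of_front hε hs hode hint hbdd
  intro t ht
  rcases (hnn t ht).lt_or_eq with h | h
  · exact h
  · exfalso
    obtain ⟨t₂, ht₂, hne₂⟩ := hne
    exact hne₂ (eq_zero_of_zero hε hs hode hnn ht h.symm t₂ ht₂)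

/-- **Leading-edge comparison**: along a non-negative profile the drain is non-negative, so
`a'(t) ≤ (Λ/s²)·a(t/s)²` — the shell is driven by the one below it only. [elementary] -/
theorem deriv_le_feed (hε : 0 < ε₀) (hs : 1 < s)
    (hode : ∀ t : ℝ, t < 0 → HasDerivAt a
      (bigLam ε₀ / s ^ 2 * a (t / s) ^ 2 - s / bigLam ε₀ * a t * a (s * t)) t)
    (hnn : ∀ t : ℝ, t < 0 → 0 ≤ a t) {t : ℝ} (ht : t < 0) :
    deriv a t ≤ bigLam ε₀ / s ^ 2 * a (t / s) ^ 2 := by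
  have hs0 : 0 < s := by linarith
  have hΛ : 0 < bigLam ε₀ := bigLam_pos (by linarith)
  rw [(hode t ht).deriv]
  have h1 : 0 ≤ s / bigLam ε₀ * a t * a (s * t) :=
    mul_nonneg (mul_nonneg (div_pos hs0 hΛ).le (hnn t ht)) (hnn _ (mul_neg_of_pos_of_neg hs0 ht))
  linarith

/-! ## Quasi-monotonicity and the wake fraction -/

/-- **Quasi-monotonicity.**  For a non-negative integrable profile, `a(t) ≥ e^{−A/Λ}·a(t₀)` for all
`t₀ ≤ t < 0`, `A = ∫_{t<0} a` (the drain exponent `(s/Λ)∫_{t₀}^{t} a(sv)dv` is at most `(s/Λ)·A/s`).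
[cite: Tao2016AveragedNS, §1.2; elementary] -/
theorem quasi_monotone (hε : 0 < ε₀) (hs : 1 < s)
    (hode : ∀ t : ℝ, t < 0 → HasDerivAt a
      (bigLam ε₀ / s ^ 2 * a (t / s) ^ 2 - s / bigLam ε₀ * a t * a (s * t)) t)
    (hint : IntegrableOn a (Iio 0)) (hnn : ∀ t : ℝ, t < 0 → 0 ≤ a t)
    {t₀ t : ℝ} (ht₀t : t₀ ≤ t) (ht : t < 0) :
    a t₀ * Real.exp (-((∫ v in Iio 0, a v) / bigLam ε₀)) ≤ a t := by
  have hs0 : 0 < s := by linarith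
  have hΛ : 0 < bigLam ε₀ := bigLam_pos (by linarith)
  have hg := lower_gronwall hε hs hode ht₀t ht
  have h1 : ∫ v in t₀..t, a (s * v) ≤ ∫ v in Iio 0, |a (s * v)| :=
    (le_abs_self _).trans (drainPrim_abs_le hs0 hint ht₀t ht)
  have h2 : ∫ v in Iio 0, |a (s * v)| = s⁻¹ * ∫ v in Iio 0, a v := by
    rw [integral_comp_mul_Iio (fun v => |a v|) hs0]
    congr 1
    exact setIntegral_congr_fun measurableSet_Iio fun v hv => abs_of_nonneg (hnn v hv)
  have hexp : Real.exp (-((∫ v in Iio 0, a v) / bigLam ε₀))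
      ≤ Real.exp (-(s / bigLam ε₀ * ∫ v in t₀..t, a (s * v))) := by
    apply Real.exp_le_exp.2
    have h3 : s / bigLam ε₀ * ∫ v in t₀..t, a (s * v) ≤ (∫ v in Iio 0, a v) / bigLam ε₀ :=
      calc s / bigLam ε₀ * ∫ v in t₀..t, a (s * v)
          ≤ s / bigLam ε₀ * (s⁻¹ * ∫ v in Iio 0, a v) :=
            mul_le_mul_of_nonneg_left (h1.trans h2.le) (div_pos hs0 hΛ).le
        _ = (∫ v in Iio 0, a v) / bigLam ε₀ := by field_simp
    linarith
  have ha0 : 0 ≤ a t₀ := hnn t₀ (lt_of_le_of_lt ht₀t ht)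
  exact (mul_le_mul_of_nonneg_left hexp ha0).trans hg

/-- **The wake retains a fixed fraction of every earlier value**: if `a → L` at `0⁻`, then
`L ≥ e^{−A/Λ}·a(t₀)` for every `t₀ < 0` (`A = ∫_{t<0} a`); in particular `a(0⁻) ≥ e^{−A/Λ}·sup a`.
[cite: Tao2016AveragedNS, §1.2; elementary] -/
theorem wake_ge (hε : 0 < ε₀) (hs : 1 < s)
    (hode : ∀ t : ℝ, t < 0 → HasDerivAt a
      (bigLam ε₀ / s ^ 2 * a (t / s) ^ 2 - s / bigLam ε₀ * a t * a (s * t)) t)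
    (hint : IntegrableOn a (Iio 0)) (hnn : ∀ t : ℝ, t < 0 → 0 ≤ a t)
    {L : ℝ} (hL : Tendsto a (𝓝[<] 0) (𝓝 L)) {t₀ : ℝ} (ht₀ : t₀ < 0) :
    a t₀ * Real.exp (-((∫ v in Iio 0, a v) / bigLam ε₀)) ≤ L := by
  refine ge_of_tendsto hL ?_
  filter_upwards [Ico_mem_nhdsLT ht₀] with t htI
  exact quasi_monotone hε hs hode hint hnn htI.1 htI.2

/-- **Wake fraction for the construction item**: every profile of `DyadicScalarFronts` has a wake limit
`L = a(0⁻)` with `L ≥ e^{−A/Λ}·a(t₀)` for all `t₀ < 0`. [cite: Tao2016AveragedNS, §1.2, §4; elementary] -/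
theorem wake_ge_of_front (hε : 0 < ε₀) (hs : 1 < s)
    (hode : ∀ t : ℝ, t < 0 → HasDerivAt a
      (bigLam ε₀ / s ^ 2 * a (t / s) ^ 2 - s / bigLam ε₀ * a t * a (s * t)) t)
    (hint : IntegrableOn a (Iio 0))
    (hbdd : ∃ t₀ : ℝ, t₀ < 0 ∧ ∃ P : ℝ, ∀ t : ℝ, t₀ ≤ t → t < 0 → |a t| ≤ P) :
    ∃ L : ℝ, Tendsto a (𝓝[<] 0) (𝓝 L) ∧
      ∀ t₀ : ℝ, t₀ < 0 → a t₀ * Real.exp (-((∫ v in Iio 0, a v) / bigLam ε₀)) ≤ L := by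
  obtain ⟨L, hL⟩ := WakeRatchetScalarFront.exists_wake_limit hε hs hode hbdd
  exact ⟨L, hL, fun t₀ ht₀ =>
    wake_ge hε hs hode hint (nonneg_of_front hε hs hode hint hbdd) hL ht₀⟩

/-! ## Positive throughput -/

/-- **Positive throughput.**  The energy flux integral `∫_{t<0} a(t)² a(st) dt` of a non-trivial profile of
`DyadicScalarFronts` is positive (strictly positive continuous integrand on a set of positive measure).
[cite: Tao2016AveragedNS, §1.2 (energy transfer `λⁿ X_{n+1} X_n²`); elementary] -/
theorem flux_integral_pos_of_front (hε : 0 < ε₀) (hs : 1 < s)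
    (hode : ∀ t : ℝ, t < 0 → HasDerivAt a
      (bigLam ε₀ / s ^ 2 * a (t / s) ^ 2 - s / bigLam ε₀ * a t * a (s * t)) t)
    (hint : IntegrableOn a (Iio 0))
    (hbdd : ∃ t₀ : ℝ, t₀ < 0 ∧ ∃ P : ℝ, ∀ t : ℝ, t₀ ≤ t → t < 0 → |a t| ≤ P)
    (hne : ∃ t : ℝ, t < 0 ∧ a t ≠ 0) :
    0 < ∫ t in Iio 0, a t ^ 2 * a (s * t) := by
  have hs0 : 0 < s := by linarith
  have hpos := pos_of_front hε hs hode hint hbdd hne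
  obtain ⟨P', hP'⟩ := bounded hε hs hode hint hbdd
  have hq : IntegrableOn (fun t => a t ^ 2 * a (s * t)) (Iio 0) :=
    integrableOn_flux hs0 (continuousOn_of_ode hode) hP' hint
  have hnn : 0 ≤ᵐ[volume.restrict (Iio 0)] fun t => a t ^ 2 * a (s * t) :=
    (ae_restrict_iff' measurableSet_Iio).2 (Eventually.of_forall fun t ht =>
      mul_nonneg (sq_nonneg _) (hpos _ (mul_neg_of_pos_of_neg hs0 ht)).le)
  rw [setIntegral_pos_iff_support_of_nonneg_ae hnn hq]
  have hsub : Iio (0 : ℝ) ⊆ Function.support (fun t => a t ^ 2 * a (s * t)) ∩ Iio 0 := by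
    intro t ht
    refine ⟨?_, ht⟩
    rw [Function.mem_support]
    exact mul_ne_zero (pow_ne_zero 2 (hpos t ht).ne') (hpos _ (mul_neg_of_pos_of_neg hs0 ht)).ne'
  refine lt_of_lt_of_le ?_ (measure_mono hsub)
  have : Ioo (-1 : ℝ) 0 ⊆ Iio 0 := fun t ht => ht.2
  refine lt_of_lt_of_le ?_ (measure_mono this)
  rw [Real.volume_Ioo]
  norm_num

end WakeRatchetScalarFrontPositive

end Summit.NavierStokesRegularity.NavierStokesRegularity.Theorems

end
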